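/-
Copyright (c) 2026. All rights reserved.
Released under Apache 2.0 license as described in the file LICENSE.
Authors: abc-iut cell, statement-typer seat abc-iut-L4-t3 (wave 1; gen 6).
-/
import Literature.AnabelianGeometry.AbsoluteAnabelian.LogFrobeniusNonarchGenuineOverIotaOver
import Literature.AnabelianGeometry.AbsoluteAnabelian.LogFrobeniusLamOverLink
import HarnessLib

/-!
# [AbsTopIII] Cor 5.5 p. 130 proviso (`LamOverLink`) AT THE SETTING OVER A SUB-MODEL `ι : C ⥤ 𝒳` and at the SLIM carrier

S. Mochizuki, *Topics in absolute anabelian geometry III: global reconstruction algorithms*,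
J. Math. Sci. Univ. Tokyo 22 (2015) 939–1156 [MochizukiAbsTopIII2015]; manuscript (`paper:url-5493eb38cbb7`) Cor 5.5 p. 130
("subject to the proviso that we identify the functors associated to the space-link and post-log vertices"), Def 5.4 (iv)
pp. 126–127, (vii) p. 128.

PROOF-ONLY follow-up of `LogFrobeniusLamOverLink` at abc-iut-w4-d095's carriers `nonarchGenuineOver p ι` (the genuine
nonarchimedean setting over any sub-model `ι : C ⥤ 𝒳`) and `nonarchGenuineSlim p` (the slim id-rigid MLF carrier, where
abc-iut-f-102's THEOREM B inputs and total `□`-rigidity F-0155 meet): the add-on law `LamOverLink` holds (the two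
"lies over `Th•[Z]`" structure isomorphisms at the space-link and post-log vertices are the same identity), so THEOREM B's
binder list `IotaOver ∧ LamOverLink` is available there together with `nonarchGenuineOver_iotaOver`.

Typed-scope hygiene of OUR interface; nothing here bears on [IUTchIII] Cor. 3.12; no side taken; typed ≠ proved.
-/

set_option autoImplicit false

open CategoryTheory

namespace Literature.AnabelianGeometry.AbsoluteAnabelian

namespace LogFrobeniusSetting

open AbsTopIII

variable (p : ℕ) [Fact p.Prime] {C : Type 1} [Category.{1} C] (ι : C ⥤ TFModel p) (Vmod : Type 1)
  (isArc : Vmod → Bool)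

/-- **`LamOverLink` HOLDS at the setting over any sub-model `ι : C ⥤ 𝒳`**. [cite: MochizukiAbsTopIII2015, Cor 5.5 p. 130] -/
theorem nonarchGenuineOver_lamOverLink : (nonarchGenuineOver p ι Vmod isArc).LamOverLink := by
  intro v
  change HEq (overLamOver p ι (isArc v) (LogVertex.spaceLink (isArc v)))
    (overLamOver p ι (isArc v) (LogVertex.postLog (isArc v)))
  generalize isArc v = b
  cases b <;> exact HEq.rfl

/-- **THEOREM B's binder list at the setting over a sub-model**: `IotaOver ∧ LamOverLink`.
[cite: MochizukiAbsTopIII2015, Def 5.4 (vii) p. 128] -/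
theorem nonarchGenuineOver_iotaOver_and_lamOverLink :
    (nonarchGenuineOver p ι Vmod isArc).IotaOver ∧ (nonarchGenuineOver p ι Vmod isArc).LamOverLink :=
  ⟨nonarchGenuineOver_iotaOver p ι Vmod isArc, nonarchGenuineOver_lamOverLink p ι Vmod isArc⟩

/-- **`LamOverLink` HOLDS at the SLIM id-rigid MLF carrier**. [cite: MochizukiAbsTopIII2015, Cor 5.5 p. 130] -/
theorem nonarchGenuineSlim_lamOverLink : (nonarchGenuineSlim p Vmod isArc).LamOverLink :=
  nonarchGenuineOver_lamOverLink p _ Vmod isArc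

/-- At the slim carrier: `IotaOver ∧ LamOverLink ∧ Cor55CoreRigid` (THEOREM B inputs and F-0155 together).
[cite: MochizukiAbsTopIII2015, Def 5.4 (vii) p. 128] -/
theorem nonarchGenuineSlim_iotaOver_lamOverLink_coreRigid :
    (nonarchGenuineSlim p Vmod isArc).IotaOver ∧ (nonarchGenuineSlim p Vmod isArc).LamOverLink ∧
      (nonarchGenuineSlim p Vmod isArc).Cor55CoreRigid :=
  ⟨(nonarchGenuineSlim_iotaOver_and_coreRigid p Vmod isArc).1, nonarchGenuineSlim_lamOverLink p Vmod isArc,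
    (nonarchGenuineSlim_iotaOver_and_coreRigid p Vmod isArc).2⟩

end LogFrobeniusSetting

end Literature.AnabelianGeometry.AbsoluteAnabelian
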